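import Summits.ResolutionOfSingularities.ResolutionOfSingularities.Theorems.PinchTowerTau

/-!
# NearExit (S6-C) — the contraction lemma: orders at a rational point of the blow-up pull back to WEIGHTS

Node «NearExit» of `decomp-res-lens-2` (g33), see `NearExitTau.lean`.  Ring-level kernel (C) of the proof of
`VeryNearCutClasses.VeryNearExit` at a RATIONAL point of the first blow-up.

Setting: `σ : R → L` a ring map of local rings (`L` Noetherian), `b : Fin (d+1) → R` a basis of `𝔪_R` (the
"twisted" regular system of parameters `b_j = c_j`, `b_k = c_k − ŵ_k c_j`), `t ∈ L` and `y : Fin (d+1) → L` with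
`σ b_j = t`, `σ b_k = t·y_k (k ≠ j)`, and `(y_k)_{k ≠ j}, t` (the family `update y j t`) part of a regular system of
parameters of `L` (the rational point of the chart `c_j ≠ 0` with coordinates `y_k = c_k/c_j − ŵ_k`).

WEIGHT of an exponent `β`: `wt β = |β| + Σ_{k ≠ j} β_k` (`= β.degree + (β.erase j).degree`): `ord_L σ(b^β) = wt β`.

* `contraction` [KERNEL C]: if `σ(F(b)) ∈ 𝔪_Lˡ` then `F(b) = F′(b)` for a polynomial `F′` all of whose monomials have
  weight `≥ l` — by induction on `l`, the weight-`l` layer being controlled by the QUASI-REGULARITY of a regular system of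
  parameters of `L` extending `(t, y)` (`isQuasiRegular_rsop_comp`): its coefficients map into `𝔪_L`, hence lie in `𝔪_R`,
  and `𝔪_R · (weight l) ⊆ (weight l+1)`.
* `sigma_eval_mem_pow`: conversely weight `≥ l` maps into `𝔪_Lˡ`.

Sources: [Matsumura1987] Thm. 16.2 (quasi-regularity); [CossartPiltant2008] §4; [Hironaka1970] Thm. 3.
-/

open IsLocalRing
open Literature.AlgebraicGeometry.Resolution
open MvPolynomial

namespace Summit.ResolutionOfSingularities.ResolutionOfSingularities.Theorems.NearExit

section Theta

variable {d : ℕ}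

/-- The `L`-exponent of `σ(b^β)` in the variables `update y j t`: `β + (Σ_{k ≠ j} β_k)·e_j`. [this file] -/
noncomputable def theta (j : Fin (d + 1)) (β : Fin (d + 1) →₀ ℕ) : Fin (d + 1) →₀ ℕ :=
  β + Finsupp.single j (Finsupp.erase j β).degree

/-- `θ_j β` agrees with `β` off the slot `j`. [this file] -/
theorem theta_apply_of_ne (j : Fin (d + 1)) (β : Fin (d + 1) →₀ ℕ) {k : Fin (d + 1)} (hk : k ≠ j) :
    theta j β k = β k := by
  rw [theta, Finsupp.add_apply, Finsupp.single_eq_of_ne hk, add_zero]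

/-- The slot `j` of `θ_j β` is `β_j + |β off j|`. [this file] -/
theorem theta_apply_self (j : Fin (d + 1)) (β : Fin (d + 1) →₀ ℕ) :
    theta j β j = β j + (Finsupp.erase j β).degree := by
  rw [theta, Finsupp.add_apply, Finsupp.single_eq_same]

/-- Erasing the slot `j` undoes `θ_j`. [this file] -/
theorem erase_theta (j : Fin (d + 1)) (β : Fin (d + 1) →₀ ℕ) :
    Finsupp.erase j (theta j β) = Finsupp.erase j β := by
  ext k
  by_cases hk : k = j
  · subst hk; rw [Finsupp.erase_same, Finsupp.erase_same]
  · rw [Finsupp.erase_ne hk, Finsupp.erase_ne hk, theta_apply_of_ne j β hk]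

/-- `θ` is injective. [this file] -/
theorem theta_injective (j : Fin (d + 1)) : Function.Injective (theta j) := by
  intro β β' h
  have he : Finsupp.erase j β = Finsupp.erase j β' := by rw [← erase_theta j β, h, erase_theta]
  ext k
  by_cases hk : k = j
  · subst hk
    have h1 := congrArg (fun γ => γ k) h
    simp only [theta_apply_self] at h1
    rw [he] at h1
    omega
  · have := congrArg (fun γ => γ k) he
    simpa [Finsupp.erase_ne hk] using this

/-- `deg θ(β) = wt β`. [this file] -/
theorem degree_theta (j : Fin (d + 1)) (β : Fin (d + 1) →₀ ℕ) :
    (theta j β).degree = β.degree + (Finsupp.erase j β).degree := by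
  rw [theta, map_add, Finsupp.degree_single]

/-- The degree of a finitely supported function on `Fin m` is the sum of its values. [folklore] -/
theorem degree_eq_sum_univ {m : ℕ} (β : Fin m →₀ ℕ) : β.degree = ∑ k, β k := by
  rw [Finsupp.degree_apply]
  exact Finset.sum_subset (Finset.subset_univ _) fun k _ hk => by simpa using hk

/-- The degree of `β` off the slot `j`, as a sum over `Fin d` via `j.succAbove`. [folklore] -/
theorem degree_erase_eq_sum (j : Fin (d + 1)) (β : Fin (d + 1) →₀ ℕ) :
    (Finsupp.erase j β).degree = ∑ i : Fin d, β (j.succAbove i) := by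
  rw [degree_eq_sum_univ, Fin.sum_univ_succAbove _ j, Finsupp.erase_same, zero_add]
  exact Finset.sum_congr rfl fun i _ => Finsupp.erase_ne (Fin.succAbove_ne j i)

/-- `wt (β + e_k) ≥ wt β + 1`. [this file] -/
theorem wt_add_single (j k : Fin (d + 1)) (β : Fin (d + 1) →₀ ℕ) :
    β.degree + (Finsupp.erase j β).degree + 1 ≤
      (β + Finsupp.single k 1).degree + (Finsupp.erase j (β + Finsupp.single k 1)).degree := by
  rw [map_add, Finsupp.degree_single, Finsupp.erase_add, map_add]
  omega

end Theta

section Transport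

variable {R L : Type} [CommRing R] [CommRing L] (σ : R →+* L) {d : ℕ} (j : Fin (d + 1))
  (b : Fin (d + 1) → R) (t : L) (y : Fin (d + 1) → L) (hbj : σ (b j) = t)
  (hbk : ∀ k, k ≠ j → σ (b k) = t * y k)

include hbj hbk in
/-- `σ(b^β) = (update y j t)^{θ β}`. [this file] -/
theorem map_monomial_prod (β : Fin (d + 1) →₀ ℕ) :
    σ (β.prod fun k e => b k ^ e) = (theta j β).prod fun k e => Function.update y j t k ^ e := by
  rw [map_finsuppProd, Finsupp.prod_pow, Fin.prod_univ_succAbove _ j]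
  simp only [map_pow]
  rw [Finsupp.prod_pow, Fin.prod_univ_succAbove _ j, Function.update_self, theta_apply_self, hbj,
    degree_erase_eq_sum, pow_add, ← Finset.prod_pow_eq_pow_sum]
  rw [mul_assoc]
  congr 1
  rw [← Finset.prod_mul_distrib]
  refine Finset.prod_congr rfl fun i _ => ?_
  rw [Function.update_of_ne (Fin.succAbove_ne j i), theta_apply_of_ne j β (Fin.succAbove_ne j i),
    hbk _ (Fin.succAbove_ne j i), mul_pow]

include hbj hbk in
/-- `σ(F(b)) = Φ(update y j t)` for the transported polynomial `Φ = Σ_β σ(F_β) X^{θ β}`. [this file] -/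
theorem map_eval_eq (F : MvPolynomial (Fin (d + 1)) R) :
    σ (eval b F) = eval (Function.update y j t)
      (∑ β ∈ F.support, monomial (theta j β) (σ (coeff β F))) := by
  conv_lhs => rw [F.as_sum]
  rw [map_sum, map_sum, map_sum]
  refine Finset.sum_congr rfl fun β _ => ?_
  rw [eval_monomial, eval_monomial, map_mul, map_monomial_prod σ j b t y hbj hbk]

/-- Coefficients of the transported polynomial. [this file] -/
theorem coeff_theta_transport (F : MvPolynomial (Fin (d + 1)) R) (B : Finset (Fin (d + 1) →₀ ℕ))
    (β : Fin (d + 1) →₀ ℕ) (hβ : β ∈ B) :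
    coeff (theta j β) (∑ β' ∈ B, monomial (theta j β') (σ (coeff β' F)) : MvPolynomial (Fin (d + 1)) L) =
      σ (coeff β F) := by
  rw [coeff_sum, Finset.sum_eq_single β]
  · rw [coeff_monomial, if_pos rfl]
  · intro β' _ hne
    rw [coeff_monomial, if_neg]
    exact fun h => hne (theta_injective j h.symm).symm
  · exact fun h => absurd hβ h

/-- If all exponents in `B` have weight `l`, the transported polynomial is homogeneous of degree `l`. [this file] -/
theorem isHomogeneous_transport (F : MvPolynomial (Fin (d + 1)) R) (B : Finset (Fin (d + 1) →₀ ℕ)) (l : ℕ)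
    (hB : ∀ β ∈ B, β.degree + (Finsupp.erase j β).degree = l) :
    (∑ β' ∈ B, monomial (theta j β') (σ (coeff β' F)) : MvPolynomial (Fin (d + 1)) L).IsHomogeneous l := by
  refine IsHomogeneous.sum _ _ _ fun β hβ => isHomogeneous_monomial _ ?_
  rw [degree_theta, hB β hβ]

end Transport

section Contraction

variable {R L : Type} [CommRing R] [IsLocalRing R] [CommRing L] [IsLocalRing L]
  (σ : R →+* L) {d : ℕ} (j : Fin (d + 1)) (b : Fin (d + 1) → R) (t : L) (y : Fin (d + 1) → L)
  (hbj : σ (b j) = t) (hbk : ∀ k, k ≠ j → σ (b k) = t * y k) (hrsop : IsRsopPart (Function.update y j t))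

omit [IsLocalRing R] in
include hbj hbk hrsop in
/-- Weight `≥ l` maps into `𝔪_Lˡ`. [this file] -/
theorem sigma_eval_mem_pow (l : ℕ) (F : MvPolynomial (Fin (d + 1)) R)
    (hF : ∀ β ∈ F.support, l ≤ β.degree + (Finsupp.erase j β).degree) :
    σ (eval b F) ∈ maximalIdeal L ^ l := by
  rw [map_eval_eq σ j b t y hbj hbk F, map_sum]
  refine Ideal.sum_mem _ fun β hβ => ?_
  rw [eval_monomial]
  refine Ideal.mul_mem_left _ _ (Ideal.pow_le_pow_right (hF β hβ) ?_)
  rw [← degree_theta j β, Finsupp.prod_pow, degree_eq_sum_univ, ← Finset.prod_pow_eq_pow_sum]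
  exact Ideal.prod_mem_prod fun k _ => Ideal.pow_mem_pow (hrsop.mem_maximalIdeal k) _

include hrsop in
/-- Quasi-regularity: a form of degree `l` in `update y j t` with value in `𝔪_Lˡ⁺¹` has coefficients in `𝔪_L`.
[cite: Matsumura1987, Thm. 16.2] -/
theorem coeff_mem_of_eval_mem_pow_succ {l : ℕ} (Φ : MvPolynomial (Fin (d + 1)) L) (hΦ : Φ.IsHomogeneous l)
    (h : eval (Function.update y j t) Φ ∈ maximalIdeal L ^ (l + 1)) (γ : Fin (d + 1) →₀ ℕ) :
    coeff γ Φ ∈ maximalIdeal L := by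
  haveI := hrsop.isRegularLocalRing
  obtain ⟨e, x, hd, hx, hxz⟩ := hrsop.exists_rsop
  have hq : IsQuasiRegular x := by
    simpa using isQuasiRegular_rsop_comp hd x hx id Function.injective_id
  have hΦ' : (rename (Fin.castAdd e) Φ).IsHomogeneous l := hΦ.rename_isHomogeneous
  have hxe : x ∘ Fin.castAdd e = Function.update y j t := funext fun i => hxz i
  have hev : eval x (rename (Fin.castAdd e) Φ) = eval (Function.update y j t) Φ := by
    rw [eval_rename, hxe]
  have hmem := hq l (rename (Fin.castAdd e) Φ) hΦ' (by rw [hev, hx]; exact h)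
  rw [hx, mem_map_C_iff] at hmem
  have := hmem (Finsupp.mapDomain (Fin.castAdd e) γ)
  rwa [coeff_rename_mapDomain _ (Fin.castAdd_injective _ _)] at this

/-- `σ r ∈ 𝔪_L ⇒ r ∈ 𝔪_R` (units map to units). [folklore] -/
theorem mem_maximalIdeal_of_map_mem {r : R} (h : σ r ∈ maximalIdeal L) :
    r ∈ maximalIdeal R := by
  by_contra hr
  have hu : IsUnit r := by
    by_contra hu
    exact hr ((IsLocalRing.mem_maximalIdeal _).mpr hu)
  exact (IsLocalRing.mem_maximalIdeal _).mp h (hu.map σ)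

include hbj hbk hrsop in
/-- **THE CONTRACTION LEMMA** [KERNEL C]: `σ(F(b)) ∈ 𝔪_Lˡ` ⇒ `F(b) = F′(b)` with all monomials of `F′` of weight
`≥ l` (`wt β = |β| + Σ_{k≠j} β_k`). [cite: CossartPiltant2008, §4] [cite: Matsumura1987, Thm. 16.2] -/
theorem contraction (hbm : Ideal.span (Set.range b) = maximalIdeal R) (l : ℕ)
    (F : MvPolynomial (Fin (d + 1)) R) (hF : σ (eval b F) ∈ maximalIdeal L ^ l) :
    ∃ F' : MvPolynomial (Fin (d + 1)) R, eval b F' = eval b F ∧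
      ∀ β ∈ F'.support, l ≤ β.degree + (Finsupp.erase j β).degree := by
  classical
  induction l generalizing F with
  | zero => exact ⟨F, rfl, fun _ _ => Nat.zero_le _⟩
  | succ l ih =>
    obtain ⟨F₁, hF₁e, hF₁w⟩ := ih F (Ideal.pow_le_pow_right (Nat.le_succ l) hF)
    -- the weight-`l` layer of `F₁`
    set B : Finset (Fin (d + 1) →₀ ℕ) :=
      F₁.support.filter fun β => β.degree + (Finsupp.erase j β).degree = l with hB
    have hBl : ∀ β ∈ B, β.degree + (Finsupp.erase j β).degree = l := fun β hβ => (Finset.mem_filter.mp hβ).2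
    set Flow : MvPolynomial (Fin (d + 1)) R := ∑ β ∈ B, monomial β (coeff β F₁) with hFlow
    have hcoeff_low : ∀ β, coeff β Flow = if β ∈ B then coeff β F₁ else 0 := by
      intro β
      rw [hFlow, coeff_sum]
      simp_rw [coeff_monomial]
      rw [Finset.sum_ite_eq']
    set Fhigh : MvPolynomial (Fin (d + 1)) R := F₁ - Flow with hFhigh
    have hhigh_w : ∀ β ∈ Fhigh.support, l + 1 ≤ β.degree + (Finsupp.erase j β).degree := by
      intro β hβ
      rw [mem_support_iff, hFhigh, coeff_sub, hcoeff_low] at hβ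
      by_cases hβB : β ∈ B
      · rw [if_pos hβB, sub_self] at hβ; exact absurd rfl hβ
      · rw [if_neg hβB, sub_zero] at hβ
        have h1 := hF₁w β (mem_support_iff.mpr hβ)
        have h2 : β.degree + (Finsupp.erase j β).degree ≠ l := fun h =>
          hβB (Finset.mem_filter.mpr ⟨mem_support_iff.mpr hβ, h⟩)
        omega
    have hhigh_mem : σ (eval b Fhigh) ∈ maximalIdeal L ^ (l + 1) :=
      sigma_eval_mem_pow σ j b t y hbj hbk hrsop (l + 1) Fhigh hhigh_w
    have hlow_mem : σ (eval b Flow) ∈ maximalIdeal L ^ (l + 1) := by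
      have : Flow = F₁ - Fhigh := by rw [hFhigh]; ring
      rw [this, map_sub, map_sub, hF₁e]
      exact Ideal.sub_mem _ hF hhigh_mem
    -- quasi-regularity: the weight-`l` coefficients lie in `𝔪_R`
    have hcoeff : ∀ β ∈ B, coeff β F₁ ∈ maximalIdeal R := by
      intro β hβ
      refine mem_maximalIdeal_of_map_mem σ ?_
      have hΦ := isHomogeneous_transport σ j F₁ B l hBl
      have hevΦ : eval (Function.update y j t) (∑ β' ∈ B, monomial (theta j β') (σ (coeff β' F₁))) =
          σ (eval b Flow) := by
        rw [map_eval_eq σ j b t y hbj hbk Flow]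
        congr 1
        -- same sums: `Flow.support ⊆ B` and coefficients agree
        rw [← Finset.sum_subset (s₁ := Flow.support) (s₂ := B)]
        · refine Finset.sum_congr rfl fun β' hβ' => ?_
          have hβ'B : β' ∈ B := by
            have := mem_support_iff.mp hβ'
            rw [hcoeff_low] at this
            by_contra h; exact this (if_neg h)
          rw [hcoeff_low, if_pos hβ'B]
        · intro β' hβ'
          have := mem_support_iff.mp hβ'
          rw [hcoeff_low] at this
          by_contra h; exact this (if_neg h)
        · intro β' hβ'B hβ's
          have h0 := notMem_support_iff.mp hβ's
          rw [hcoeff_low, if_pos hβ'B] at h0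
          rw [h0, map_zero, monomial_zero]
      have hc := coeff_mem_of_eval_mem_pow_succ j t y hrsop _ hΦ (by rw [hevΦ]; exact hlow_mem) (theta j β)
      rwa [coeff_theta_transport σ j F₁ B β hβ] at hc
    -- absorb: `coeff β F₁ = Σ_k s β k · b_k`
    have hs : ∀ β ∈ B, ∃ s : Fin (d + 1) → R, ∑ k, s k * b k = coeff β F₁ := fun β hβ =>
      Ideal.mem_span_range_iff_exists_fun.mp (by rw [hbm]; exact hcoeff β hβ)
    choose! s hs using hs
    refine ⟨Fhigh + ∑ β ∈ B, ∑ k, monomial (β + Finsupp.single k 1) (s β k), ?_, ?_⟩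
    · -- values agree
      rw [map_add, ← hF₁e, hFhigh, map_sub, sub_add_eq_add_sub, add_sub_assoc]
      convert add_zero (eval b F₁) using 2
      rw [sub_eq_zero, map_sum, hFlow, map_sum]
      refine Finset.sum_congr rfl fun β hβ => ?_
      rw [map_sum, eval_monomial, ← hs β hβ, Finset.sum_mul]
      refine Finset.sum_congr rfl fun k _ => ?_
      rw [monomial_add_single, map_mul, eval_monomial, map_pow, eval_X, pow_one]
      ring
    · -- weights
      intro β hβ
      rcases Finset.mem_union.mp (support_add hβ) with h1 | h2
      · exact hhigh_w β h1
      · obtain ⟨β', hβ'B, hβ2⟩ := Finset.mem_biUnion.mp (support_sum h2)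
        obtain ⟨k, -, hβ3⟩ := Finset.mem_biUnion.mp (support_sum hβ2)
        have hβ4 := support_monomial_subset hβ3
        rw [Finset.mem_singleton] at hβ4
        subst hβ4
        have := wt_add_single j k β'
        rw [hBl β' hβ'B] at this
        exact this

end Contraction

end Summit.ResolutionOfSingularities.ResolutionOfSingularities.Theorems.NearExit
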